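import Literature.MathematicalPhysics.QuantumManyBody.TorusFockLayer
import Literature.MathematicalPhysics.QuantumManyBody.PeriodicBoseGasFracEnergy
import HarnessLib

/-!
# Route `BECPhaseQuadratureSumRule` — route-posited objects (the c-number split in first quantisation)

Shared vocabulary of the prover files `Theorems/BECPhaseQuadratureSumRuleSumRuleChainGlue*.lean` of the glue item
`SumRuleChainGlue` (stmt-AtomisticToContinuum-12627). For an `N = n + 2`-body wave function `Ψ` on the torus of
side `L` and a momentum label `p ∈ ℤ³` with wave vector `k = 2πp/L` (`kvec`):

* `condAn L Ψ = a_0 Ψ` (the tree's `modeAn` of the constant plane wave `planeWaveMode L 0`) and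
  `pairOcc L p Ψ = ‖a_p a_0 Ψ‖²` — the off-diagonal part of `E_Ψ[N̂₀ n̂_p]`, whose sum over `p ≠ 0` is
  `E_Ψ[N̂₀(N - N̂₀)]` and whose value at `p = 0` is the pair term of `CondensateNumberConcentration`;
* the four amplitudes of the route's statements, VERBATIM their integrands: the longitudinal current
  `currentAmp` (`A_pΨ = Σⱼ e_p(xⱼ)(-2i∂_{xⱼ·k} + ‖k‖²)Ψ`, the `m₂`-integrand of `CurrentSumRule`), its non-condensate
  part `currentAmpNc` and the non-condensate density `densityAmpNc` (the two integrands of `NonCondensateRemainders`),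
  and the density `densityAmp` (`ρ_p†Ψ = Σⱼ e_p(xⱼ)Ψ`, whose square norm is `N S_p`).

Definitions only (real, over tree declarations); their algebra (`a_p†a_0 ∓ a_0†a_{-p}` are `(A - A^{nc})/‖k‖²` and
`ρ† - ρ^{nc†}` pointwise) is proved in the `…PerMode` file. [cite: LiebSeiringerYngvason2005, (c-number substitution)];
[cite: Stringari1995, §2.3 (19)–(23)].
-/

noncomputable section

open MeasureTheory Complex
open scoped ENNReal NNReal ComplexConjugate BigOperators

namespace Summit.AtomisticToContinuum.BoseEinsteinCondensation.Theorems.SumRuleChainGlue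

open Literature.MathematicalPhysics.QuantumManyBody.BoseGas
variable {n : ℕ}

/-- The wave vector `k = 2πp/L` of the label `p`, written as in the route's statements. -/
def kvec (L : ℝ) (p : Fin 3 → ℤ) : Space := (2 * Real.pi / L) • latticeVec 1 p

/-- `a_0 Ψ`: one particle annihilated in the constant mode (an `(n+1)`-body function of an `(n+2)`-body one). -/
def condAn (L : ℝ) (Ψ : Config (n + 2) → ℂ) : Config (n + 1) → ℂ :=
  modeAn L (planeWaveMode L 0) Ψ

/-- `T_p(Ψ) = ‖a_p a_0 Ψ‖²_{L²(cell^n)}`. -/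
def pairOcc (L : ℝ) (p : Fin 3 → ℤ) (Ψ : Config (n + 2) → ℂ) : ℝ≥0∞ :=
  ∫⁻ Y in cellN n L, (‖modeAn L (planeWaveMode L p) (condAn L Ψ) Y‖₊ : ℝ≥0∞) ^ 2

/-- The longitudinal current amplitude `(A_p Ψ)(X) = Σⱼ e_p(xⱼ)(-2i ∂_{xⱼ·k}Ψ + ‖k‖²Ψ)` (integrand of `m₂`
in `CurrentSumRule`). -/
def currentAmp (L : ℝ) (p : Fin 3 → ℤ) (Ψ : Config (n + 2) → ℂ) (X : Config (n + 2)) : ℂ :=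
  ∑ j : Fin (n + 2), cellWave L p (X j) * ((-2 * Complex.I) * fderiv ℝ Ψ X (Pi.single j (kvec L p)) +
    (((‖kvec L p‖ ^ 2 : ℝ)) : ℂ) * Ψ X)

/-- The non-condensate current amplitude `(A_p^{nc} Ψ)(X)` (first remainder of
`NonCondensateRemainders`). -/
def currentAmpNc (L : ℝ) (p : Fin 3 → ℤ) (Ψ : Config (n + 2) → ℂ) (X : Config (n + 2)) : ℂ :=
  ∑ j : Fin (n + 2), (cellWave L p (X j) * ((-2 * Complex.I) * fderiv ℝ Ψ X (Pi.single j (kvec L p)) +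
    (((‖kvec L p‖ ^ 2 : ℝ)) : ℂ) * (Ψ X - (((L ^ 3)⁻¹ : ℝ) : ℂ) * ∫ y in cell L, Ψ (Function.update X j y))) +
    (((‖kvec L p‖ ^ 2 : ℝ)) : ℂ) * ((((L ^ 3)⁻¹ : ℝ) : ℂ) * ∫ y in cell L, cellWave L p y * Ψ (Function.update X j y)))

/-- The density amplitude `(ρ_p† Ψ)(X) = Σⱼ e_p(xⱼ) Ψ(X)`. -/
def densityAmp (L : ℝ) (p : Fin 3 → ℤ) (Ψ : Config (n + 2) → ℂ) (X : Config (n + 2)) : ℂ :=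
  ∑ j : Fin (n + 2), cellWave L p (X j) * Ψ X

/-- The non-condensate density amplitude `(ρ_p^{nc†} Ψ)(X)` (second remainder of
`NonCondensateRemainders`). -/
def densityAmpNc (L : ℝ) (p : Fin 3 → ℤ) (Ψ : Config (n + 2) → ℂ) (X : Config (n + 2)) : ℂ :=
  ∑ j : Fin (n + 2), (cellWave L p (X j) * (Ψ X - (((L ^ 3)⁻¹ : ℝ) : ℂ) * ∫ y in cell L, Ψ (Function.update X j y)) -
    (((L ^ 3)⁻¹ : ℝ) : ℂ) * ∫ y in cell L, cellWave L p y * Ψ (Function.update X j y))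

end Summit.AtomisticToContinuum.BoseEinsteinCondensation.Theorems.SumRuleChainGlue

end
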